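import Summits.BirchSwinnertonDyer.BirchSwinnertonDyer.Theorems.Rank2Observatory2DescClIndexCertNorm
import Literature.NumberTheory.NumberFields.CubicFieldDedekindKummer
import Literature.NumberTheory.NumberFields.CubicFieldConductor
import HarnessLib

/-!
# BirchSwinnertonDyer — rank ≥ 2 observatory: KERNEL-2DESC-CL generic layer — the local index certificate ONE PRIME AT A TIME

HONEST FRAMING: per-curve certified theorems and census instruments; no claim on BSD in rank ≥ 2.

`Rank2Observatory2DescClIndexCert[Norm]` package the local certificates at ALL square primes of `Δ(g)` into the
global statement `𝓞 K = ℤ[θ]` (`RingOfIntegers.exponent θ = 1`).  For a NON-monogenic cubic field (about a third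
of the rank-2 even-class-number population: some prime divides the index of every generator) that global statement is
false, but Dedekind–Kummer (`MonicCubic.exists_factor_of_mem_primesOver'`, Mathlib
`NumberField.Ideal.primesOverSpanEquivMonicFactorsMod`) only needs the PER-PRIME hypothesis `p ∤ exponent(θ)`.
This file proves that hypothesis one prime at a time, from either certificate available at that prime:

* `TwoDescCl.mem_adjoin_of_mul_mem_of_refute` — **`ℤ[θ]` is `p`-saturated in `𝓞 K`** (`p·w ∈ ℤ[θ]`, `w ∈ 𝓞 K`
  ⇒ `w ∈ ℤ[θ]`) as soon as no `(x + yθ + zθ²)/p` with `(x, y, z) ∈ [0, p)³ ∖ 0` is an algebraic integer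
  (reduce the coordinates of `p·w` mod `p`); `…_of_pow_mul_mem_of_refute` — the same for `pᵏ·w`;
* `TwoDescCl.not_dvd_exponent_of_refute` — hence **`p ∤ exponent(θ)`**: with `|Δ(g)| = pᵏ·N`, `p ∤ N`,
  `Δ(g)·x ∈ ℤ[θ]` for every `x ∈ 𝓞 K` (`MonicCubic.disc_mul_mem_adjoin`), so `N·x ∈ ℤ[θ]` by saturation, so
  `exponent(θ) ∣ N` (`MonicCubic.not_dvd_exponent`);
* `TwoDescCl.not_dvd_exponent_of_localCertNorm` / `…_of_localCert` — the refutation supplied by the normalised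
  (`p² + p + 1` triples) or the plain (`p³ − 1` triples) Boolean certificate at `p`, evaluated by `decide`;
* `TwoDescCl.dvd_indexDet_of_rep` (any degree; converse of `exists_of_dvd_indexDet`) — an algebraic integer
  `(∑ vⱼθʲ)/p` with `v ∈ [0, p)ⁿ ∖ 0` forces `p ∣ indexDet` (the matrix of `1, θ, …, θⁿ⁻¹` in an integral basis is
  singular mod `p`); with `Δ(g) = indexDet² · d_K` this gives
* `TwoDescCl.not_dvd_exponent_of_not_sq_dvd` — **`p² ∤ Δ(g) ⇒ p ∤ exponent(θ)`** (no enumeration: the form needed at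
  the large primes dividing `d_K` exactly once), and `…_of_not_dvd_disc` (`p ∤ Δ(g)`).

With these a field file for a non-monogenic `K = ℚ(θ)` proves `hexp p` for exactly the primes it factors through `θ`,
and factors an index prime `q` through a second generator `θ_q ∈ 𝓞 K` of the same field with `q ∤ [𝓞 K : ℤ[θ_q]]`
(available for `q ≠ 2`, and for `q = 2` unless `2` splits completely), certified by the same lemmas at that one prime.

Sorry-free; axioms `propext`, `Classical.choice`, `Quot.sound`.
[cite: Marcus2018, Ch. 2, Thm. 9, Thm. 13 and Exercise 27; Ch. 3, Thm. 27 and Exercise 20] [cite: Cohen1993, §4.8.2, §6.2]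
-/

-- single-conjunct summit: `Summit.BirchSwinnertonDyer.BirchSwinnertonDyer.…` repeats the name by design
set_option linter.dupNamespace false

noncomputable section

open scoped NumberField
open Module NumberField Polynomial

namespace Summit.BirchSwinnertonDyer.BirchSwinnertonDyer.Rank2Observatory.TwoDescCl

open Literature.NumberTheory.NumberFields

variable {K : Type*} [Field K] [NumberField K]

/-! ## Any degree: an integral `(∑ vⱼ θʲ)/p` forces `p ∣ indexDet` -/

/-- **Converse of `exists_of_dvd_indexDet`.** If `p·w = ∑ⱼ vⱼ θʲ` for an algebraic integer `w` and a residue vector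
`v ∈ [0, p)ⁿ ∖ 0`, then `p ∣ indexDet B` (apply the integral-basis coordinates: `M·v ≡ 0 (mod p)` with `v̄ ≠ 0`, so
`det M ≡ 0`). [cite: Marcus2018, Ch. 2, Thm. 13 and Exercise 27] -/
theorem dvd_indexDet_of_rep (B : PowerBasis ℚ K) (hint : IsIntegral ℤ B.gen) {n : ℕ} (hn : B.dim = n)
    (p : ℕ) [hp : Fact p.Prime] (v : Fin n → ℕ) (hv : ∀ j, v j < p) (hv0 : ∃ j, v j ≠ 0)
    (w : 𝓞 K) (hw : (p : K) * w = ∑ j, (v j : K) * B.gen ^ (j : ℕ)) :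
    (p : ℤ) ∣ indexDet B hint := by
  classical
  subst hn
  set M : Matrix (Fin B.dim) (Fin B.dim) ℤ := (intBasis B).toMatrix (powInt B hint) with hM
  have hdet : M.det = indexDet B hint := by rw [indexDet, Basis.det_apply]
  -- the identity in `𝓞 K`
  have key : (p : ℤ) • w = ∑ j, (v j : ℤ) • powInt B hint j := by
    apply RingOfIntegers.ext
    simpa [zsmul_eq_mul, coe_powInt, PowerBasis.coe_basis] using hw
  -- integral-basis coordinates: `p · [w]ᵢ = ∑ⱼ vⱼ Mᵢⱼ`
  have hcoord : ∀ i, (p : ℤ) * (intBasis B).repr w i = ∑ j, M i j * (v j : ℤ) := by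
    intro i
    have h := congrArg (fun x : 𝓞 K => (intBasis B).repr x i) key
    simp only [map_zsmul, map_sum, Finsupp.smul_apply, Finsupp.finsetSum_apply, smul_eq_mul] at h
    rw [h]
    refine Finset.sum_congr rfl fun j _ => ?_
    rw [hM, Basis.toMatrix_apply, mul_comm]
  have hMv : M.mulVec (fun j => (v j : ℤ)) = fun i => (p : ℤ) * (intBasis B).repr w i := by
    funext i
    rw [Matrix.mulVec, dotProduct, hcoord i]
  -- reduce mod `p`
  set f := Int.castRingHom (ZMod p) with hf
  have hvec : (M.map f).mulVec (f ∘ fun j => (v j : ℤ)) = 0 := by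
    funext i
    have h := RingHom.map_mulVec f M (fun j => (v j : ℤ)) i
    rw [hMv] at h
    simp only [map_mul, map_natCast, ZMod.natCast_self, zero_mul] at h
    rw [Pi.zero_apply, ← h]
  have hv0' : (f ∘ fun j => (v j : ℤ)) ≠ 0 := by
    obtain ⟨j, hj⟩ := hv0
    intro h
    have hj' := congr_fun h j
    simp only [Function.comp_apply, Pi.zero_apply, hf, map_natCast] at hj'
    rw [ZMod.natCast_eq_zero_iff] at hj'
    exact hj (Nat.eq_zero_of_dvd_of_lt hj' (hv j))
  have hdet0 : (M.map f).det = 0 := Matrix.exists_mulVec_eq_zero_iff.mp ⟨_, hv0', hvec⟩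
  have h1 : f M.det = 0 := by rw [RingHom.map_det, RingHom.mapMatrix_apply, hdet0]
  rw [← hdet]
  exact (ZMod.intCast_zmod_eq_zero_iff_dvd _ p).mp (by simpa [hf] using h1)

/-! ## Cubic fields: saturation of `ℤ[θ]` at one prime and `p ∤ exponent(θ)` -/

section Cubic

variable {a b c : ℤ} {θ : K}

omit [NumberField K] in
/-- `u + vθ + wθ² ∈ ℤ[θ]` for integers `u v w`. [folklore] -/
theorem lin_intCast_mem_adjoin (θ : K) (u v w : ℤ) :
    (u : K) + (v : K) * θ + (w : K) * θ ^ 2 ∈ Algebra.adjoin ℤ ({θ} : Set K) := by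
  have hθ : θ ∈ Algebra.adjoin ℤ ({θ} : Set K) := Algebra.subset_adjoin (Set.mem_singleton θ)
  exact add_mem (add_mem (intCast_mem _ u) (mul_mem (intCast_mem _ v) hθ))
    (mul_mem (intCast_mem _ w) (pow_mem hθ 2))

/-- Casting `m mod k` into a ring, integer version: `↑(m % k) = ↑m − ↑k·↑(m / k)`. [folklore] -/
theorem intCast_emod_eq_sub {R : Type*} [Ring R] (m k : ℤ) :
    ((m % k : ℤ) : R) = (m : R) - (k : R) * ((m / k : ℤ) : R) := by
  rw [Int.emod_def, Int.cast_sub, Int.cast_mul]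

/-- **`ℤ[θ]` is `p`-saturated in `𝓞 K`** when no `(x + yθ + zθ²)/p`, `(x, y, z) ∈ [0, p)³ ∖ 0`, is an algebraic
integer: `p·w ∈ ℤ[θ]`, `w ∈ 𝓞 K` ⇒ `w ∈ ℤ[θ]`.  (Write `p·w = u + vθ + sθ²`; subtracting `⌊u/p⌋ + ⌊v/p⌋θ + ⌊s/p⌋θ²`
leaves an algebraic integer `w'` with `p·w' = (u mod p) + (v mod p)θ + (s mod p)θ²`; a non-zero residue triple is
refuted, a zero one gives `w' = 0`.) [cite: Marcus2018, Ch. 2, Exercise 27] -/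
theorem mem_adjoin_of_mul_mem_of_refute (hθ : aeval θ (MonicCubic.poly a b c) = 0) (p : ℕ) (hp : p.Prime)
    (href : ∀ x y z : ℕ, x < p → y < p → z < p → (x ≠ 0 ∨ y ≠ 0 ∨ z ≠ 0) →
      ∀ w : 𝓞 K, (p : K) * w ≠ (x : K) + (y : K) * θ + (z : K) * θ ^ 2)
    (w : 𝓞 K) (hw : (p : K) * w ∈ Algebra.adjoin ℤ ({θ} : Set K)) :
    (w : K) ∈ Algebra.adjoin ℤ ({θ} : Set K) := by
  obtain ⟨u, v, s, huvs⟩ := MonicCubic.exists_coords_of_mem_adjoin hθ hw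
  have hp0 : (0 : ℤ) < p := by exact_mod_cast hp.pos
  have hpne : (p : ℤ) ≠ 0 := by exact_mod_cast hp.ne_zero
  set w' : 𝓞 K := w - (((u / p : ℤ) : 𝓞 K) + ((v / p : ℤ) : 𝓞 K) * MonicCubic.thetaInt hθ +
    ((s / p : ℤ) : 𝓞 K) * MonicCubic.thetaInt hθ ^ 2) with hw'
  have e : ((w' : 𝓞 K) : K) =
      (w : K) - (((u / p : ℤ) : K) + ((v / p : ℤ) : K) * θ + ((s / p : ℤ) : K) * θ ^ 2) := by
    simp [hw', MonicCubic.coe_thetaInt]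
  have hw'K : (p : K) * w' =
      ((u % p : ℤ) : K) + ((v % p : ℤ) : K) * θ + ((s % p : ℤ) : K) * θ ^ 2 := by
    rw [e, mul_sub, huvs, intCast_emod_eq_sub u p, intCast_emod_eq_sub v p, intCast_emod_eq_sub s p]
    push_cast
    ring
  by_cases h0 : u % p = 0 ∧ v % p = 0 ∧ s % p = 0
  · -- zero residues: `w' = 0`, so `w = ⌊u/p⌋ + ⌊v/p⌋θ + ⌊s/p⌋θ² ∈ ℤ[θ]`
    obtain ⟨hu0, hv0, hs0⟩ := h0
    have hzero : (p : K) * w' = 0 := by rw [hw'K, hu0, hv0, hs0]; push_cast; ring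
    have hpK : (p : K) ≠ 0 := by exact_mod_cast hp.ne_zero
    have hw'0 : ((w' : 𝓞 K) : K) = 0 := (mul_eq_zero.mp hzero).resolve_left hpK
    rw [e, sub_eq_zero] at hw'0
    rw [hw'0]
    exact lin_intCast_mem_adjoin θ _ _ _
  · -- a non-zero residue triple in `[0, p)³`: refuted
    obtain ⟨x, hx⟩ : ∃ x : ℕ, (x : ℤ) = u % p := ⟨(u % p).toNat, Int.toNat_of_nonneg (Int.emod_nonneg u hpne)⟩
    obtain ⟨y, hy⟩ : ∃ y : ℕ, (y : ℤ) = v % p := ⟨(v % p).toNat, Int.toNat_of_nonneg (Int.emod_nonneg v hpne)⟩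
    obtain ⟨z, hz⟩ : ∃ z : ℕ, (z : ℤ) = s % p := ⟨(s % p).toNat, Int.toNat_of_nonneg (Int.emod_nonneg s hpne)⟩
    have hxp : x < p := by
      have h := Int.emod_lt_of_pos u hp0; rw [← hx] at h; exact_mod_cast h
    have hyp : y < p := by
      have h := Int.emod_lt_of_pos v hp0; rw [← hy] at h; exact_mod_cast h
    have hzp : z < p := by
      have h := Int.emod_lt_of_pos s hp0; rw [← hz] at h; exact_mod_cast h
    have hne' : ¬ (x = 0 ∧ y = 0 ∧ z = 0) := by
      rintro ⟨rfl, rfl, rfl⟩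
      exact h0 ⟨by simpa using hx.symm, by simpa using hy.symm, by simpa using hz.symm⟩
    have hne : x ≠ 0 ∨ y ≠ 0 ∨ z ≠ 0 := by omega
    rw [← hx, ← hy, ← hz] at hw'K
    push_cast at hw'K
    exact absurd hw'K (href x y z hxp hyp hzp hne w')

/-- `pᵏ·w ∈ ℤ[θ]` ⇒ `w ∈ ℤ[θ]`, under the same refutation hypothesis at `p`. [cite: Marcus2018, Ch. 2, Exercise 27] -/
theorem mem_adjoin_of_pow_mul_mem_of_refute (hθ : aeval θ (MonicCubic.poly a b c) = 0) (p : ℕ) (hp : p.Prime)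
    (href : ∀ x y z : ℕ, x < p → y < p → z < p → (x ≠ 0 ∨ y ≠ 0 ∨ z ≠ 0) →
      ∀ w : 𝓞 K, (p : K) * w ≠ (x : K) + (y : K) * θ + (z : K) * θ ^ 2)
    (k : ℕ) (w : 𝓞 K) (hw : (p : K) ^ k * w ∈ Algebra.adjoin ℤ ({θ} : Set K)) :
    (w : K) ∈ Algebra.adjoin ℤ ({θ} : Set K) := by
  induction k generalizing w with
  | zero => simpa using hw
  | succ k ih =>
    have h1 : (p : K) ^ k * (((p : 𝓞 K) * w : 𝓞 K) : K) ∈ Algebra.adjoin ℤ ({θ} : Set K) := by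
      have : (p : K) ^ k * (((p : 𝓞 K) * w : 𝓞 K) : K) = (p : K) ^ (k + 1) * w := by push_cast; ring
      rw [this]; exact hw
    have h2 := ih ((p : 𝓞 K) * w) h1
    push_cast at h2
    exact mem_adjoin_of_mul_mem_of_refute hθ p hp href w h2

/-- `Δ(g) ≠ 0` for an irreducible cubic over `ℚ` (the discriminant of the power basis of a separable extension).
[cite: Marcus2018, Ch. 2, Thm. 8] -/
theorem disc_ne_zero (hirr : Irreducible (MonicCubic.polyQ a b c))
    (hθ : aeval θ (MonicCubic.poly a b c) = 0) (h3 : finrank ℚ K = 3) : MonicCubic.disc a b c ≠ 0 := by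
  have h := Algebra.discr_not_zero_of_basis ℚ (MonicCubic.pb hirr hθ h3).basis
  rw [MonicCubic.discr_pb hirr hθ h3] at h
  exact_mod_cast h

/-- `|Δ(g)| · x ∈ ℤ[θ]` for every algebraic integer `x`. [cite: Marcus2018, Ch. 2, Thm. 9] -/
theorem natAbs_disc_mul_mem_adjoin (hirr : Irreducible (MonicCubic.polyQ a b c))
    (hθ : aeval θ (MonicCubic.poly a b c) = 0) (h3 : finrank ℚ K = 3) (x : 𝓞 K) :
    (((MonicCubic.disc a b c).natAbs : ℕ) : K) * x ∈ Algebra.adjoin ℤ ({θ} : Set K) := by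
  have hΔ : ((MonicCubic.disc a b c : ℤ) : K) * x ∈ Algebra.adjoin ℤ ({θ} : Set K) :=
    MonicCubic.disc_mul_mem_adjoin hirr hθ h3 x
  rw [← Int.cast_natCast (R := K) (MonicCubic.disc a b c).natAbs, Int.natCast_natAbs]
  rcases abs_choice (MonicCubic.disc a b c) with h | h
  · rw [h]; exact hΔ
  · rw [h, Int.cast_neg, neg_mul]; exact neg_mem hΔ

/-- **`p ∤ exponent(θ)` from a refutation of every `(x + yθ + zθ²)/p`, `(x, y, z) ∈ [0, p)³ ∖ 0`, at the single
prime `p`.**  (`|Δ(g)| = pᵏ·N` with `p ∤ N`; `|Δ(g)|·x ∈ ℤ[θ]`, so `N·x ∈ ℤ[θ]` by saturation, so `exponent(θ) ∣ N`.)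
[cite: Marcus2018, Ch. 2, Thm. 9; Ch. 3, Thm. 27 and Exercise 20] -/
theorem not_dvd_exponent_of_refute (hirr : Irreducible (MonicCubic.polyQ a b c))
    (hθ : aeval θ (MonicCubic.poly a b c) = 0) (h3 : finrank ℚ K = 3) (p : ℕ) (hp : p.Prime)
    (href : ∀ x y z : ℕ, x < p → y < p → z < p → (x ≠ 0 ∨ y ≠ 0 ∨ z ≠ 0) →
      ∀ w : 𝓞 K, (p : K) * w ≠ (x : K) + (y : K) * θ + (z : K) * θ ^ 2) :
    ¬ p ∣ RingOfIntegers.exponent (MonicCubic.thetaInt hθ) := by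
  set D := (MonicCubic.disc a b c).natAbs with hDdef
  have hD0 : D ≠ 0 := Int.natAbs_ne_zero.mpr (disc_ne_zero hirr hθ h3)
  have hN : ¬ p ∣ D / p ^ D.factorization p := Nat.not_dvd_ordCompl hp hD0
  have hDN : p ^ D.factorization p * (D / p ^ D.factorization p) = D := Nat.ordProj_mul_ordCompl_eq_self D p
  refine MonicCubic.not_dvd_exponent hθ (N := D / p ^ D.factorization p) (fun x => ?_) hN
  have hDx : ((D : ℕ) : K) * x ∈ Algebra.adjoin ℤ ({θ} : Set K) := natAbs_disc_mul_mem_adjoin hirr hθ h3 x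
  have hpow : (p : K) ^ D.factorization p * ((((D / p ^ D.factorization p : ℕ) : 𝓞 K) * x : 𝓞 K) : K) ∈
      Algebra.adjoin ℤ ({θ} : Set K) := by
    have e : (p : K) ^ D.factorization p * ((((D / p ^ D.factorization p : ℕ) : 𝓞 K) * x : 𝓞 K) : K) =
        ((D : ℕ) : K) * x := by
      conv_rhs => rw [← hDN]
      push_cast; ring
    rw [e]; exact hDx
  have h := mem_adjoin_of_pow_mul_mem_of_refute hθ p hp href _ _ hpow
  push_cast at h
  exact h

/-- **`p ∤ exponent(θ)` from the NORMALISED Boolean local certificate at `p`** (`p² + p + 1` triples, `decide`).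
[cite: Marcus2018, Ch. 2, Thm. 13 and Exercise 27; Ch. 3, Thm. 27] -/
theorem not_dvd_exponent_of_localCertNorm (hirr : Irreducible (MonicCubic.polyQ a b c))
    (hθ : aeval θ (MonicCubic.poly a b c) = 0) (h3 : finrank ℚ K = 3) (p : ℕ) (hp : p.Prime)
    (hc : localCertOKNorm a b c p = true) :
    ¬ p ∣ RingOfIntegers.exponent (MonicCubic.thetaInt hθ) :=
  not_dvd_exponent_of_refute hirr hθ h3 p hp fun x y z hx hy hz hne w =>
    localCertNorm_sound hirr hθ h3 p hp hc x y z hx hy hz hne w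

/-- `p ∤ exponent(θ)` from the plain Boolean local certificate `localCertOK` at `p` (`p³ − 1` triples).
[cite: Marcus2018, Ch. 2, Thm. 13 and Exercise 27; Ch. 3, Thm. 27] -/
theorem not_dvd_exponent_of_localCert (hirr : Irreducible (MonicCubic.polyQ a b c))
    (hθ : aeval θ (MonicCubic.poly a b c) = 0) (h3 : finrank ℚ K = 3) (p : ℕ) (hp : p.Prime)
    (hc : localCertOK a b c p = true) :
    ¬ p ∣ RingOfIntegers.exponent (MonicCubic.thetaInt hθ) :=
  not_dvd_exponent_of_refute hirr hθ h3 p hp fun x y z hx hy hz hne w =>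
    localCert_sound hirr hθ h3 p hc x y z hx hy hz hne w

/-- **`p² ∤ Δ(g) ⇒ p ∤ exponent(θ)`** — no enumeration (`Δ(g) = indexDet² · d_K` and `dvd_indexDet_of_rep`); the form
used at the large primes dividing `d_K` exactly once. [cite: Marcus2018, Ch. 2, Exercise 27; Ch. 3, Thm. 27] -/
theorem not_dvd_exponent_of_not_sq_dvd (hirr : Irreducible (MonicCubic.polyQ a b c))
    (hθ : aeval θ (MonicCubic.poly a b c) = 0) (h3 : finrank ℚ K = 3) (p : ℕ) (hp : p.Prime)
    (h2 : ¬ (p : ℤ) ^ 2 ∣ MonicCubic.disc a b c) :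
    ¬ p ∣ RingOfIntegers.exponent (MonicCubic.thetaInt hθ) := by
  refine not_dvd_exponent_of_refute hirr hθ h3 p hp fun x y z hx hy hz hne w hw => h2 ?_
  haveI := Fact.mk hp
  have hpd : (p : ℤ) ∣ indexDet (MonicCubic.pb hirr hθ h3) (MonicCubic.isIntegral_pb_gen hirr hθ h3) := by
    refine dvd_indexDet_of_rep _ _ (MonicCubic.pb_dim hirr hθ h3) p ![x, y, z] ?_ ?_ w ?_
    · intro j
      fin_cases j
      · exact hx
      · exact hy
      · exact hz
    · rcases hne with h | h | h
      · exact ⟨0, h⟩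
      · exact ⟨1, h⟩
      · exact ⟨2, h⟩
    · rw [Fin.sum_univ_three, MonicCubic.pb_gen, hw]
      simp
  have hdQ : (MonicCubic.disc a b c : ℚ) =
      ((indexDet (MonicCubic.pb hirr hθ h3) (MonicCubic.isIntegral_pb_gen hirr hθ h3) : ℤ) : ℚ) ^ 2 *
        NumberField.discr K := by
    rw [← MonicCubic.discr_pb hirr hθ h3]
    exact discr_powerBasis_eq_indexDet_sq_mul_discr _ _
  have hdZ : MonicCubic.disc a b c =
      indexDet (MonicCubic.pb hirr hθ h3) (MonicCubic.isIntegral_pb_gen hirr hθ h3) ^ 2 * NumberField.discr K := by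
    exact_mod_cast hdQ
  rw [hdZ]
  exact Dvd.dvd.mul_right (pow_dvd_pow_of_dvd hpd 2) _

/-- `p ∤ Δ(g) ⇒ p ∤ exponent(θ)`. [cite: Marcus2018, Ch. 3, Thm. 27] -/
theorem not_dvd_exponent_of_not_dvd_disc (hirr : Irreducible (MonicCubic.polyQ a b c))
    (hθ : aeval θ (MonicCubic.poly a b c) = 0) (h3 : finrank ℚ K = 3) (p : ℕ) (hp : p.Prime)
    (h1 : ¬ (p : ℤ) ∣ MonicCubic.disc a b c) :
    ¬ p ∣ RingOfIntegers.exponent (MonicCubic.thetaInt hθ) :=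
  not_dvd_exponent_of_not_sq_dvd hirr hθ h3 p hp fun h => h1 (dvd_trans (dvd_pow_self _ two_ne_zero) h)

end Cubic

end Summit.BirchSwinnertonDyer.BirchSwinnertonDyer.Rank2Observatory.TwoDescCl

end
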